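import Mathlib
import HarnessLib
import Literature.Geometry.Lorentzian.Stationary
import Literature.Geometry.Lorentzian.IPlusRegular
import Literature.Geometry.Lorentzian.Geodesic
import Literature.Geometry.Lorentzian.Einstein
import Literature.Geometry.Lorentzian.Causality
import Literature.Geometry.Lorentzian.CausalityOpennessProofs
import Literature.Geometry.Lorentzian.MullerZumHagenAnalyticity
import Literature.Analysis.Calculus.AnalyticCauchyEstimates
import Literature.Geometry.Lorentzian.StationaryComovingChart

/-!
# `NonTrappingHawkingRigidity` (crux stmt-FinalStateConjecture-13896), line `Sketch` — stub `stub_twoVariableAnalyticitySeeds`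

Registered stub of the lead's skeleton `Cruxes/NonTrappingHawkingRigidity/Lines/Sketch.lean`
(namespace `…Cruxes.NonTrappingHawkingRigidity.AzimuthalPartialAnalyticity`, `Holds.stub_twoVariableAnalyticitySeeds`).
The statement below is the REGISTERED signature, letter for letter (Literature vocabulary only).

## What is proved

Stub S4a, the FREE part of the engine C⁺ of the line: under the crux binders h1–h16 of
`NonTrappingHawkingRigidity` and the named fact
`Literature.Geometry.Lorentzian.mullerZumHagen1970_analytic_of_timelikeKilling` taken as an explicit
HYPOTHESIS (it is the separately registered literature debt S4c), at every point `q` of the domain of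
outer communications at which the stationary Killing field `T` is timelike OR which lies on the collar
`U` of the horizon, the metric is *two-variable analytic at `q`* in the sense of the line's vocabulary
`TwoVariableAnalyticAt`: there is a chart `ψ` of the maximal `C^∞` atlas around `q` whose coordinate
2-plane `span{∂₀, ∂₁}` is timelike at `q` and whose metric components
`G_{ab}(p) = g_{ψ⁻¹ p}(dψ⁻¹_p a, dψ⁻¹_p b)` are, pair by pair, `C^∞` on a coordinate ball about `ψ q`
inside `ψ.target` and satisfy uniform Cauchy estimates `‖Dᵏ G_{ab}(z)(v₁, …, v_k)‖ ≤ M Cᵏ k!` there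
for all directions `vᵢ ∈ {𝐞₀, 𝐞₁}`.

## Proof

1. (Müller zum Hagen 1970, as reported by Hawking–Ellis 1973, §9.3 p. 324.) The hypothesis applied to
   the global smooth Killing field `T` (`U := univ`; `StationaryAFBlackHole.isStationaryKilling`) at a
   point where `T` is timelike, resp. to the collar pair `(U, K)` (smooth and Killing on `U` by h9–h10,
   timelike at `q ∈ U ∩ doc` by h14), gives a chart `ψ₀` of the maximal atlas around `q` with ALL
   components real-analytic on `ψ₀.target`, and a timelike vector `v` at `q` (`T q`, resp. `K q`).
2. TILT (Lee 2012, Thm. 9.22, linear change of coordinates): compose `ψ₀` with a continuous linear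
   automorphism `T` of `E4` taking `dψ₀(v) ≠ 0` to `𝐞₀`
   (`exists_continuousLinearEquiv_apply_eq`, `transHomeomorph_continuousLinearEquiv_mem_maximalAtlas`
   of `StationaryComovingChart.lean`); in `ψ := T ∘ ψ₀` one has `∂₀|_q = dψ₀⁻¹(T⁻¹ 𝐞₀) = v`, timelike,
   and the components of `ψ` are `G⁰_{T⁻¹a, T⁻¹b} ∘ T⁻¹` (chain rule on `ψ.target`), still real-analytic.
3. BOUNDS (Krantz–Parks 2002, Prop. 2.2.10, necessity): for each pair `(a, b)` the tree's
   `AnalyticOnNhd.exists_ball_norm_iteratedFDeriv_le` gives `‖Dᵏ G_{ab}(z)‖ ≤ M Cᵏ k!` on a ball about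
   `ψ q`, shrunk into the open `ψ.target`; the directional bounds follow from `‖𝐞ᵢ‖ = 1`, and smoothness
   on the ball from analyticity (`AnalyticOnNhd.contDiffOn_of_completeSpace`).

## References

* H. Müller zum Hagen, Proc. Cambridge Philos. Soc. 68 (1970) 199–201, Theorem. [MullerZumHagen1970]
* S. W. Hawking, G. F. R. Ellis, *The Large Scale Structure of Space-Time* (1973), §9.3 p. 324.
  [HawkingEllis1973]
* S. G. Krantz, H. R. Parks, *A Primer of Real Analytic Functions*, 2nd ed. (2002), Prop. 2.2.10.
  [KrantzParks2002]
* J. M. Lee, *Introduction to Smooth Manifolds*, 2nd ed. (2012), Thm. 9.22. [LeeSmoothManifolds2013]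
-/

noncomputable section

-- D-0017: single-problem summit, `Summit.<S>.<S>.…` by design
set_option linter.dupNamespace false

namespace Summit.FinalStateConjecture.FinalStateConjecture.Theorems.NonTrappingHawkingRigidity.AzimuthalPartialAnalyticity

open Set Filter Function Bundle Literature.Geometry.Lorentzian
open scoped Manifold ContDiff Topology Nat

/-- **Stub S4a · two-variable analyticity seeds** (the free part of the engine of line `Sketch` of
`NonTrappingHawkingRigidity`). Assuming Müller zum Hagen's theorem
(`mullerZumHagen1970_analytic_of_timelikeKilling`, an explicit hypothesis), under the crux binders, at
every `q ∈ doc` with `g(T, T)(q) < 0` or `q ∈ U` there is a chart `ψ` of the maximal `C^∞` atlas around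
`q` with `span{∂₀, ∂₁}` timelike at `q` (indeed `∂₀|_q` is the timelike Killing vector) whose metric
components are, pair by pair, `C^∞` with uniform Cauchy estimates `‖Dᵏ G_{ab}(z)(v)‖ ≤ M Cᵏ k!`,
`vᵢ ∈ {𝐞₀, 𝐞₁}`, on a coordinate ball about `ψ q` inside `ψ.target`. Proof: the analytic chart of the
hypothesis (for `(univ, T)`, resp. the collar pair `(U, K)`), tilted by a linear automorphism of `E4`
taking `dψ₀` of the timelike Killing vector to `𝐞₀` (components stay analytic: composition with a linear
map), then the Cauchy estimates for analytic maps.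
[cite: MullerZumHagen1970, Theorem (pp. 199–201)] [cite: HawkingEllis1973, §9.3 p. 324]
[cite: KrantzParks2002, Prop. 2.2.10] [cite: LeeSmoothManifolds2013, Thm. 9.22] -/
theorem stub_twoVariableAnalyticitySeeds :
    mullerZumHagen1970_analytic_of_timelikeKilling →
    ∀ (𝓑 : StationaryAFBlackHole.{0}) [𝓑.metric.HasLeviCivita],
      𝓑.metric.toPseudoRiemannianMetric.IsRicciFlat → 𝓑.IsIPlusRegular →
      (∀ p : 𝓑.carrier, p ∈ 𝓑.metric.chronologicalFuture 𝓑.timeOrientation 𝓑.Mext) →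
      (∀ p ∈ 𝓑.doc, 𝓑.killing p ≠ 0) → SimplyConnectedSpace 𝓑.doc →
      ∀ (U : Set 𝓑.carrier) (K : Π x : 𝓑.carrier, TangentSpace (𝓡 4) x), IsOpen U → 𝓑.horizon ⊆ U →
      IsConnected 𝓑.horizon →
      ContMDiffOn (𝓡 4) ((𝓡 4).prod 𝓘(ℝ, E4)) ((⊤ : ℕ∞) : WithTop ℕ∞)
        (fun x ↦ (Bundle.TotalSpace.mk' E4 x (K x) : TangentBundle (𝓡 4) 𝓑.carrier)) U →
      (∀ x ∈ U, ∀ v w : TangentSpace (𝓡 4) x,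
        𝓑.metric.val x (𝓑.metric.leviCivita K x v) w + 𝓑.metric.val x v (𝓑.metric.leviCivita K x w) = 0) →
      (∀ x ∈ U, VectorField.mlieBracket (𝓡 4) 𝓑.killing K x = 0) → (∀ p ∈ 𝓑.horizon, K p ≠ 0) →
      (∀ γ : ℝ → 𝓑.carrier, IsMIntegralCurve γ K → γ 0 ∈ 𝓑.horizon → ∀ t, γ t ∈ 𝓑.horizon) →
      (∀ x ∈ U ∩ 𝓑.doc, 𝓑.metric.val x (K x) (K x) < 0) →
      (∃ S₀ : Set 𝓑.carrier, IsCompact S₀ ∧ S₀ ⊆ 𝓑.doc ∧ ∀ y ∈ 𝓑.doc,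
        0 ≤ 𝓑.metric.val y (𝓑.killing y) (𝓑.killing y) → y ∉ U → y ∈ stationaryOrbit 𝓑.killing S₀) →
      (∀ S : Set 𝓑.carrier, IsCompact S → S ⊆ 𝓑.doc → ∀ (γ : ℝ → 𝓑.carrier) (s : Set ℝ),
        IsMaximalGeodesicOn 𝓑.metric.toPseudoRiemannianMetric.leviCivita γ s → s.Nonempty →
        (∀ t ∈ s, 𝓑.metric.val (γ t) (velocity (𝓡 4) γ t) (velocity (𝓡 4) γ t) = 0 ∧
          velocity (𝓡 4) γ t ≠ 0 ∧ 𝓑.metric.val (γ t) (velocity (𝓡 4) γ t) (𝓑.killing (γ t)) = 0) →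
        ∃ t ∈ s, γ t ∉ stationaryOrbit 𝓑.killing S) →
      ∀ q ∈ 𝓑.doc, (𝓑.metric.val q (𝓑.killing q) (𝓑.killing q) < 0 ∨ q ∈ U) →
      (∃ ψ ∈ IsManifold.maximalAtlas (𝓡 4) ((⊤ : ℕ∞) : WithTop ℕ∞) 𝓑.carrier, q ∈ ψ.source ∧
        (∃ a b : ℝ, 𝓑.metric.val q
            (a • mfderiv 𝓘(ℝ, E4) (𝓡 4) ψ.symm (ψ q) (EuclideanSpace.single 0 1) +
              b • mfderiv 𝓘(ℝ, E4) (𝓡 4) ψ.symm (ψ q) (EuclideanSpace.single 1 1))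
            (a • mfderiv 𝓘(ℝ, E4) (𝓡 4) ψ.symm (ψ q) (EuclideanSpace.single 0 1) +
              b • mfderiv 𝓘(ℝ, E4) (𝓡 4) ψ.symm (ψ q) (EuclideanSpace.single 1 1)) < 0) ∧
        ∀ a b : E4, ∃ δ > (0 : ℝ), ∃ M C : ℝ, 0 ≤ M ∧ 0 ≤ C ∧ Metric.ball (ψ q) δ ⊆ ψ.target ∧
          ContDiffOn ℝ ((⊤ : ℕ∞) : WithTop ℕ∞)
            (fun p : E4 ↦ 𝓑.metric.val (ψ.symm p) (mfderiv 𝓘(ℝ, E4) (𝓡 4) ψ.symm p a) (mfderiv 𝓘(ℝ, E4) (𝓡 4) ψ.symm p b)) (Metric.ball (ψ q) δ) ∧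
          ∀ z ∈ Metric.ball (ψ q) δ, ∀ (k : ℕ) (v : Fin k → E4),
            (∀ i, v i = EuclideanSpace.single 0 1 ∨ v i = EuclideanSpace.single 1 1) →
            ‖iteratedFDeriv ℝ k
                (fun p : E4 ↦ 𝓑.metric.val (ψ.symm p) (mfderiv 𝓘(ℝ, E4) (𝓡 4) ψ.symm p a) (mfderiv 𝓘(ℝ, E4) (𝓡 4) ψ.symm p b)) z v‖ ≤ M * C ^ k * k !) := by
  intro hMzH 𝓑 _ hvac _ _ _ _ U K hU _ _ hK hKill _ _ _ htl _ _ q hq hqU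
  /- Step 1 (Müller zum Hagen): a chart `ψ₀` of the maximal atlas around `q` with all metric
  components real-analytic on `ψ₀.target`, and a timelike vector `v` at `q`. -/
  obtain ⟨ψ₀, hψ₀, hqψ₀, v, hv, hG₀⟩ :
      ∃ ψ₀ ∈ IsManifold.maximalAtlas (𝓡 4) ((⊤ : ℕ∞) : WithTop ℕ∞) 𝓑.carrier, q ∈ ψ₀.source ∧
        ∃ v : TangentSpace (𝓡 4) q, 𝓑.metric.val q v v < 0 ∧
          ∀ a b : E4, AnalyticOnNhd ℝ (fun p : E4 ↦ 𝓑.metric.val (ψ₀.symm p)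
            (mfderiv 𝓘(ℝ, E4) (𝓡 4) ψ₀.symm p a) (mfderiv 𝓘(ℝ, E4) (𝓡 4) ψ₀.symm p b))
            ψ₀.target := by
    rcases hqU with hT | hqU
    · -- `T` is a global smooth Killing field, timelike at `q`
      have hKF := 𝓑.isStationaryKilling.isKillingField
      obtain ⟨ψ₀, hψ₀, hqψ₀, hG₀⟩ := hMzH 𝓑 hvac Set.univ 𝓑.killing isOpen_univ
        hKF.contMDiff.contMDiffOn (fun x _ v w ↦ hKF.val_leviCivita_add x v w) q (mem_univ q) hT
      exact ⟨ψ₀, hψ₀, hqψ₀, 𝓑.killing q, hT, hG₀⟩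
    · -- the collar field `K`, smooth and Killing on `U`, timelike at `q ∈ U ∩ doc`
      have hqt : 𝓑.metric.val q (K q) (K q) < 0 := htl q ⟨hqU, hq⟩
      obtain ⟨ψ₀, hψ₀, hqψ₀, hG₀⟩ := hMzH 𝓑 hvac U K hU hK hKill q hqU hqt
      exact ⟨ψ₀, hψ₀, hqψ₀, K q, hqt, hG₀⟩
  /- Step 2 (tilt): compose `ψ₀` with a linear automorphism `T` of `E4` taking `dψ₀(v)` to
  `𝐞₀`, so that `∂₀ = v` at `q` in the new chart `ψ`. -/
  have hv0 : v ≠ 0 := 𝓑.ne_zero_of_val_self_neg hv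
  have hd₀ := mdifferentiable_of_mem_maximalAtlas' hψ₀
  obtain ⟨c, hc⟩ : ∃ c : E4, c = mfderiv (𝓡 4) (𝓡 4) ψ₀ q v := ⟨_, rfl⟩
  have hcv : mfderiv 𝓘(ℝ, E4) (𝓡 4) ψ₀.symm (ψ₀ q) c = v := by
    rw [hc]
    exact DFunLike.congr_fun (hd₀.symm_comp_deriv hqψ₀) v
  have hc0 : c ≠ 0 := by
    intro h0
    apply hv0
    apply hd₀.mfderiv_injective hqψ₀
    rw [← hc, h0]
    exact (ContinuousLinearMap.map_zero _).symm
  have he₀ : ‖(EuclideanSpace.single (0 : Fin 4) (1 : ℝ) : E4)‖ = 1 := by simp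
  obtain ⟨T, hT⟩ := exists_continuousLinearEquiv_apply_eq (F := E4) hc0 he₀
  have hT' : T.symm (EuclideanSpace.single (0 : Fin 4) (1 : ℝ) : E4) = c := by
    rw [← hT, T.symm_apply_apply]
  set ψ := ψ₀.transHomeomorph T.toHomeomorph with hψdef
  have hψ : ψ ∈ IsManifold.maximalAtlas (𝓡 4) ((⊤ : ℕ∞) : WithTop ℕ∞) 𝓑.carrier :=
    transHomeomorph_continuousLinearEquiv_mem_maximalAtlas hψ₀ T
  have hsrc : ψ.source = ψ₀.source := OpenPartialHomeomorph.transHomeomorph_source _ _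
  have htgt : ψ.target = T.toHomeomorph.symm ⁻¹' ψ₀.target :=
    OpenPartialHomeomorph.transHomeomorph_target _ _
  have hψapp : ∀ x, ψ x = T (ψ₀ x) := fun x ↦ rfl
  have hψsymm : ∀ p, ψ.symm p = ψ₀.symm (T.symm p) := fun p ↦ rfl
  have hTd' : ∀ p : E4, MDifferentiableAt 𝓘(ℝ, E4) 𝓘(ℝ, E4) (T.symm : E4 → E4) p := fun p ↦
    T.symm.hasMFDerivAt.mdifferentiableAt
  have hqψ : q ∈ ψ.source := by rw [hsrc]; exact hqψ₀
  have hqt : ψ q ∈ ψ.target := ψ.map_source hqψ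
  -- chain rule for `ψ⁻¹ = ψ₀⁻¹ ∘ T⁻¹` on the chart target
  have hchain : ∀ p ∈ ψ.target, ∀ a : E4, mfderiv 𝓘(ℝ, E4) (𝓡 4) ψ.symm p a =
      mfderiv 𝓘(ℝ, E4) (𝓡 4) ψ₀.symm (T.symm p) (T.symm a) := by
    intro p hp a
    have hcomp : (ψ.symm : E4 → 𝓑.carrier) = ψ₀.symm ∘ (T.symm : E4 → E4) := funext hψsymm
    have hp₀ : T.symm p ∈ ψ₀.target := by rw [htgt] at hp; exact hp
    rw [hcomp, mfderiv_comp p (hd₀.mdifferentiableAt_symm hp₀) (hTd' p), T.symm.mfderiv_eq]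
    rfl
  -- `∂₀ = v` at `q`
  have h0 : mfderiv 𝓘(ℝ, E4) (𝓡 4) ψ.symm (ψ q) (EuclideanSpace.single (0 : Fin 4) (1 : ℝ) : E4)
      = v := by
    rw [hchain _ hqt, hT', hψapp, T.symm_apply_apply, hcv]
  -- the components of `ψ` are `G₀(T⁻¹ a, T⁻¹ b) ∘ T⁻¹`, hence real-analytic on `ψ.target`
  have hG : ∀ a b : E4, AnalyticOnNhd ℝ (fun p : E4 ↦ 𝓑.metric.val (ψ.symm p)
      (mfderiv 𝓘(ℝ, E4) (𝓡 4) ψ.symm p a) (mfderiv 𝓘(ℝ, E4) (𝓡 4) ψ.symm p b)) ψ.target := by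
    intro a b
    have h1 : AnalyticOnNhd ℝ ((fun p : E4 ↦ 𝓑.metric.val (ψ₀.symm p)
        (mfderiv 𝓘(ℝ, E4) (𝓡 4) ψ₀.symm p (T.symm a))
        (mfderiv 𝓘(ℝ, E4) (𝓡 4) ψ₀.symm p (T.symm b))) ∘ (T.symm : E4 → E4)) ψ.target :=
      (hG₀ (T.symm a) (T.symm b)).comp (T.symm.analyticOnNhd _)
        (fun p hp ↦ by rw [htgt] at hp; exact hp)
    refine AnalyticOnNhd.congr ψ.open_target h1 fun p hp ↦ ?_
    show _ = 𝓑.metric.val (ψ.symm p) (mfderiv 𝓘(ℝ, E4) (𝓡 4) ψ.symm p a)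
      (mfderiv 𝓘(ℝ, E4) (𝓡 4) ψ.symm p b)
    rw [hchain p hp a, hchain p hp b]
    rfl
  /- Step 3 (bounds): Cauchy estimates for analytic maps on a ball inside the target. -/
  refine ⟨ψ, hψ, hqψ, ⟨1, 0, ?_⟩, fun a b ↦ ?_⟩
  · rw [one_smul, zero_smul, add_zero, h0]
    exact hv
  · obtain ⟨δ₁, hδ₁, M, C, hM, hC, hbd⟩ := (hG a b).exists_ball_norm_iteratedFDeriv_le hqt
    obtain ⟨δ₂, hδ₂, hball⟩ := Metric.isOpen_iff.1 ψ.open_target (ψ q) hqt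
    have h₁ : Metric.ball (ψ q) (min δ₁ δ₂) ⊆ Metric.ball (ψ q) δ₁ :=
      Metric.ball_subset_ball (min_le_left _ _)
    have h₂ : Metric.ball (ψ q) (min δ₁ δ₂) ⊆ ψ.target :=
      (Metric.ball_subset_ball (min_le_right _ _)).trans hball
    refine ⟨min δ₁ δ₂, lt_min hδ₁ hδ₂, M, C, hM, hC, h₂,
      (hG a b).contDiffOn_of_completeSpace.mono h₂, fun z hz k w hw ↦ ?_⟩
    have hw1 : ∏ i, ‖w i‖ = 1 := by
      refine Finset.prod_eq_one fun i _ ↦ ?_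
      rcases hw i with h | h <;> simp [h]
    calc ‖iteratedFDeriv ℝ k (fun p : E4 ↦ 𝓑.metric.val (ψ.symm p)
            (mfderiv 𝓘(ℝ, E4) (𝓡 4) ψ.symm p a) (mfderiv 𝓘(ℝ, E4) (𝓡 4) ψ.symm p b)) z w‖
        ≤ ‖iteratedFDeriv ℝ k (fun p : E4 ↦ 𝓑.metric.val (ψ.symm p)
            (mfderiv 𝓘(ℝ, E4) (𝓡 4) ψ.symm p a) (mfderiv 𝓘(ℝ, E4) (𝓡 4) ψ.symm p b)) z‖
            * ∏ i, ‖w i‖ := ContinuousMultilinearMap.le_opNorm _ _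
      _ ≤ M * C ^ k * k ! := by
        rw [hw1, mul_one]
        exact hbd z (h₁ hz) k

/- WORKLOG
- v1: MzH chart (T-timelike case: U := univ, K := T; collar case: (U, K)); tilt by a CLE taking dψ₀(v) to 𝐞₀ (StationaryComovingChart API); Cauchy bounds per pair (a, b).
-/

end Summit.FinalStateConjecture.FinalStateConjecture.Theorems.NonTrappingHawkingRigidity.AzimuthalPartialAnalyticity

end
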